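import Summits.MatrixMultiplication.OmegaCensus.ThreeSetTilingPartThree
import Summits.MatrixMultiplication.OmegaCensus.ThreeSetNoPartThreeCorollaries
import Summits.MatrixMultiplication.OmegaCensus.Z4Z4CubeTables
import Literature.Combinatorics.Additive.TPPGroupAlgebra
import Mathlib.GroupTheory.Exponent

/-!
# No coset part of size three in a cube law triple over ANY finite abelian group of small exponent (kernel)

ω-census `pub-omega`, family (b3), seat pub-omega-group gen 34.  Framing: lottery ticket; floor = certified bounds/negative
ranges.  VALUE: the parity-free form of the `|W| = 3` theorem (`ThreeSetNoPartThreeCorollaries` needed `|A|` odd, via the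
cube SYMMETRIC form): the cube SHIFTED form `cube_shifted_form_of_law` (g14, any parity, any `c₀`) is also a triangle tiling,
so `ThreeSetTilingPartThree.card_le_of_tiling_part_three` applies.  NOT progress on ω; no census word changes (newly KERNEL
by one theorem, previously ENGINE: the `(1,3,75)` / `(1,3,87)` cells of `ℤ₂₆², ℤ₁₃ × ℤ₅₂, ℤ₁₄ × ℤ₅₆`; the even groups with a
`ℤ₄²` quotient were already covered by `DominoPartThreeZ4Z4`, g14).

* `shifted_form_tiling` — the three-set shifted form `(κ₁ − W) + X + Y ⊔ W + (κ₂ − X) + Y ⊔ W + X + (κ₃ − Y) = A ∖ {x₀}`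
  (each box direct) is a tiling of `A ∖ {x₀}` by the `|X||Y|` translates `m − W`, `m ∈ κ₁ + X + Y`, and the `2|X||Y|`
  translates `t + W`, `t ∈ (κ₂ − X + Y) ⊔ (κ₃ + X − Y)` (counting form).
* **`card_le_of_shifted_form_part_three`** — hence `|W| = 3 ⇒ |A| ≤ 12 · addOrderOf (w' − w) + 7` for distinct `w, w' ∈ W`.
* **`cube_law_no_coset_part_three_general`** — `G` dihedral-like over ANY finite abelian `A` (any `c₀`), every element of order
  `≤ e`, `12e + 7 < |A|`: a TPP triple with cube coset parts attaining `3|S||T||U| + 8 = 8|A|` has no coset part of size `3`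
  (the three parts via `TripleProductProperty.rotate`); `cube_law_no_coset_part_three_general_of_exponent_lt`
  (`12·exp A + 7 < |A|`);
  **`cube_law_no_coset_part_three_zmod_sq`**: over `ℤ_n × ℤ_n` for EVERY `n ∉ {8, 10}` (`n = 8` is covered by
  `no_law_cube_13e_of_onto_z4z4`; `n = 10`, i.e. `(1,3,11)@ℤ₁₀²`, stays computational — census NONE, NR63).
-/

namespace Summit.MatrixMultiplication.OmegaCensus

open Finset

section Tiling

variable {A : Type*} [AddCommGroup A] [DecidableEq A]

/-- Down-tiles of the shifted form: `#{m ∈ κ₁ + X + Y : m − a ∈ W} = #{(w', x, y) ∈ (κ₁ − W) × X × Y : w' + x + y = a}`.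
[folklore] -/
theorem card_filter_shifted₁ (W X Y : Finset A) (κ₁ a : A)
    (i₁ : Set.InjOn (fun p : A × A × A => p.1 + p.2.1 + p.2.2) ↑((W.image fun w => κ₁ - w) ×ˢ X ×ˢ Y)) :
    (((W.image fun w => κ₁ - w) ×ˢ X ×ˢ Y).filter fun p : A × A × A => p.1 + p.2.1 + p.2.2 = a).card =
      (((X ×ˢ Y).image fun q : A × A => κ₁ + q.1 + q.2).filter fun m => m - a ∈ W).card := by
  refine card_bij (fun p _ => κ₁ + p.2.1 + p.2.2) ?_ ?_ ?_
  · rintro ⟨w', x, y⟩ hp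
    simp only [mem_filter, mem_product, mem_image] at hp
    obtain ⟨⟨⟨w, hw, rfl⟩, hx, hy⟩, hsum⟩ := hp
    simp only [mem_filter, mem_image, mem_product, Prod.exists]
    refine ⟨⟨x, y, ⟨hx, hy⟩, rfl⟩, ?_⟩
    rw [show κ₁ + x + y - a = w by rw [← hsum]; abel]; exact hw
  · rintro ⟨w₁, x₁, y₁⟩ hp ⟨w₂, x₂, y₂⟩ hq he
    have hp' := (mem_filter.1 hp).1; have hq' := (mem_filter.1 hq).1
    have e₁ : w₁ = w₂ := by
      have s₁ := (mem_filter.1 hp).2; have s₂ := (mem_filter.1 hq).2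
      simp only at s₁ s₂ he
      rw [show w₁ = a - (κ₁ + x₁ + y₁) + κ₁ by rw [← s₁]; abel, show w₂ = a - (κ₁ + x₂ + y₂) + κ₁ by rw [← s₂]; abel, he]
    subst e₁
    have hxy : x₁ + y₁ = x₂ + y₂ := by
      have e := he; simp only at e; rw [add_assoc, add_assoc] at e; exact add_left_cancel e
    exact i₁ (mem_coe.2 hp') (mem_coe.2 hq') (by show w₁ + x₁ + y₁ = w₁ + x₂ + y₂; rw [add_assoc, hxy, ← add_assoc])
  · intro m hm
    simp only [mem_filter, mem_image, mem_product, Prod.exists] at hm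
    obtain ⟨⟨x, y, ⟨hx, hy⟩, rfl⟩, hW⟩ := hm
    refine ⟨(κ₁ - (κ₁ + x + y - a), x, y), ?_, rfl⟩
    simp only [mem_filter, mem_product, mem_image]
    exact ⟨⟨⟨_, hW, rfl⟩, hx, hy⟩, by abel⟩

/-- Up-tiles of the second box: `#{t ∈ κ₂ − X + Y : a − t ∈ W} = #{(w, x', y) ∈ W × (κ₂ − X) × Y : w + x' + y = a}`.
[folklore] -/
theorem card_filter_shifted₂ (W X Y : Finset A) (κ₂ a : A)
    (i₂ : Set.InjOn (fun p : A × A × A => p.1 + p.2.1 + p.2.2) ↑(W ×ˢ (X.image fun x => κ₂ - x) ×ˢ Y)) :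
    ((W ×ˢ (X.image fun x => κ₂ - x) ×ˢ Y).filter fun p : A × A × A => p.1 + p.2.1 + p.2.2 = a).card =
      (((X ×ˢ Y).image fun q : A × A => κ₂ - q.1 + q.2).filter fun t => a - t ∈ W).card := by
  refine card_bij (fun p _ => p.2.1 + p.2.2) ?_ ?_ ?_
  · rintro ⟨w, x', y⟩ hp
    simp only [mem_filter, mem_product, mem_image] at hp
    obtain ⟨⟨hw, ⟨x, hx, rfl⟩, hy⟩, hsum⟩ := hp
    simp only [mem_filter, mem_image, mem_product, Prod.exists]
    refine ⟨⟨x, y, ⟨hx, hy⟩, rfl⟩, ?_⟩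
    rw [show a - (κ₂ - x + y) = w by rw [← hsum]; abel]; exact hw
  · rintro ⟨w₁, x₁, y₁⟩ hp ⟨w₂, x₂, y₂⟩ hq he
    have hp' := (mem_filter.1 hp).1; have hq' := (mem_filter.1 hq).1
    have s₁ := (mem_filter.1 hp).2; have s₂ := (mem_filter.1 hq).2
    simp only at s₁ s₂ he
    have e₁ : w₁ = w₂ := by
      rw [show w₁ = a - (x₁ + y₁) by rw [← s₁]; abel, show w₂ = a - (x₂ + y₂) by rw [← s₂]; abel, he]
    subst e₁
    exact i₂ (mem_coe.2 hp') (mem_coe.2 hq') (by simp only; rw [add_assoc, he, ← add_assoc])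
  · intro t ht
    simp only [mem_filter, mem_image, mem_product, Prod.exists] at ht
    obtain ⟨⟨x, y, ⟨hx, hy⟩, rfl⟩, hW⟩ := ht
    refine ⟨(a - (κ₂ - x + y), κ₂ - x, y), ?_, rfl⟩
    simp only [mem_filter, mem_product, mem_image]
    exact ⟨⟨hW, ⟨x, hx, rfl⟩, hy⟩, by abel⟩

/-- Up-tiles of the third box: `#{t ∈ κ₃ + X − Y : a − t ∈ W} = #{(w, x, y') ∈ W × X × (κ₃ − Y) : w + x + y' = a}`.
[folklore] -/
theorem card_filter_shifted₃ (W X Y : Finset A) (κ₃ a : A)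
    (i₃ : Set.InjOn (fun p : A × A × A => p.1 + p.2.1 + p.2.2) ↑(W ×ˢ X ×ˢ (Y.image fun y => κ₃ - y))) :
    ((W ×ˢ X ×ˢ (Y.image fun y => κ₃ - y)).filter fun p : A × A × A => p.1 + p.2.1 + p.2.2 = a).card =
      (((X ×ˢ Y).image fun q : A × A => κ₃ + q.1 - q.2).filter fun t => a - t ∈ W).card := by
  refine card_bij (fun p _ => p.2.1 + p.2.2) ?_ ?_ ?_
  · rintro ⟨w, x, y'⟩ hp
    simp only [mem_filter, mem_product, mem_image] at hp
    obtain ⟨⟨hw, hx, ⟨y, hy, rfl⟩⟩, hsum⟩ := hp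
    simp only [mem_filter, mem_image, mem_product, Prod.exists]
    refine ⟨⟨x, y, ⟨hx, hy⟩, by abel⟩, ?_⟩
    rw [show a - (x + (κ₃ - y)) = w by rw [← hsum]; abel]; exact hw
  · rintro ⟨w₁, x₁, y₁⟩ hp ⟨w₂, x₂, y₂⟩ hq he
    have hp' := (mem_filter.1 hp).1; have hq' := (mem_filter.1 hq).1
    have s₁ := (mem_filter.1 hp).2; have s₂ := (mem_filter.1 hq).2
    simp only at s₁ s₂ he
    have e₁ : w₁ = w₂ := by
      rw [show w₁ = a - (x₁ + y₁) by rw [← s₁]; abel, show w₂ = a - (x₂ + y₂) by rw [← s₂]; abel, he]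
    subst e₁
    exact i₃ (mem_coe.2 hp') (mem_coe.2 hq') (by simp only; rw [add_assoc, he, ← add_assoc])
  · intro t ht
    simp only [mem_filter, mem_image, mem_product, Prod.exists] at ht
    obtain ⟨⟨x, y, ⟨hx, hy⟩, rfl⟩, hW⟩ := ht
    refine ⟨(a - (κ₃ + x - y), x, κ₃ - y), ?_, by simp only; abel⟩
    simp only [mem_filter, mem_product, mem_image]
    exact ⟨⟨hW, hx, ⟨y, hy, rfl⟩⟩, by abel⟩

variable [Fintype A]

/-- **The three-set shifted form is a triangle tiling.**  `(κ₁ − W) + X + Y ⊔ W + (κ₂ − X) + Y ⊔ W + X + (κ₃ − Y) = A ∖ {x₀}`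
(each box direct, `W ≠ ∅`) means: the `|X||Y|` translates `m − W` (`m ∈ κ₁ + X + Y`) and the `2|X||Y|` translates `t + W`
(`t ∈ (κ₂ − X + Y) ⊔ (κ₃ + X − Y)`) partition `A ∖ {x₀}`. [folklore] -/
theorem shifted_form_tiling {W X Y : Finset A} {κ₁ κ₂ κ₃ x₀ : A} (hWne : W.Nonempty)
    (i₁ : Set.InjOn (fun p : A × A × A => p.1 + p.2.1 + p.2.2) ↑((W.image fun w => κ₁ - w) ×ˢ X ×ˢ Y))
    (i₂ : Set.InjOn (fun p : A × A × A => p.1 + p.2.1 + p.2.2) ↑(W ×ˢ (X.image fun x => κ₂ - x) ×ˢ Y))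
    (i₃ : Set.InjOn (fun p : A × A × A => p.1 + p.2.1 + p.2.2) ↑(W ×ˢ X ×ˢ (Y.image fun y => κ₃ - y)))
    (d₁₂ : Disjoint (((W.image fun w => κ₁ - w) ×ˢ X ×ˢ Y).image fun p : A × A × A => p.1 + p.2.1 + p.2.2)
      ((W ×ˢ (X.image fun x => κ₂ - x) ×ˢ Y).image fun p : A × A × A => p.1 + p.2.1 + p.2.2))
    (d₁₃ : Disjoint (((W.image fun w => κ₁ - w) ×ˢ X ×ˢ Y).image fun p : A × A × A => p.1 + p.2.1 + p.2.2)
      ((W ×ˢ X ×ˢ (Y.image fun y => κ₃ - y)).image fun p : A × A × A => p.1 + p.2.1 + p.2.2))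
    (d₂₃ : Disjoint ((W ×ˢ (X.image fun x => κ₂ - x) ×ˢ Y).image fun p : A × A × A => p.1 + p.2.1 + p.2.2)
      ((W ×ˢ X ×ˢ (Y.image fun y => κ₃ - y)).image fun p : A × A × A => p.1 + p.2.1 + p.2.2))
    (hcover : (((W.image fun w => κ₁ - w) ×ˢ X ×ˢ Y).image fun p : A × A × A => p.1 + p.2.1 + p.2.2) ∪
      ((W ×ˢ (X.image fun x => κ₂ - x) ×ˢ Y).image fun p : A × A × A => p.1 + p.2.1 + p.2.2) ∪
      ((W ×ˢ X ×ˢ (Y.image fun y => κ₃ - y)).image fun p : A × A × A => p.1 + p.2.1 + p.2.2) = univ.erase x₀) :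
    let M := (X ×ˢ Y).image fun q : A × A => κ₁ + q.1 + q.2
    let T := ((X ×ˢ Y).image fun q : A × A => κ₂ - q.1 + q.2) ∪ ((X ×ˢ Y).image fun q : A × A => κ₃ + q.1 - q.2)
    (∀ a : A, (M.filter fun m => m - a ∈ W).card + (T.filter fun t => a - t ∈ W).card = if a = x₀ then 0 else 1) ∧
      M.card = X.card * Y.card ∧ T.card = 2 * (X.card * Y.card) := by
  intro M T
  obtain ⟨w₀, hw₀⟩ := hWne
  -- pair injectivities from the box injectivities with `w₀` fixed
  have j₁ : Set.InjOn (fun q : A × A => κ₁ + q.1 + q.2) ↑(X ×ˢ Y) := by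
    intro q hq q' hq' e
    have hm : ∀ {q : A × A}, q ∈ (X ×ˢ Y : Finset (A × A)) →
        (κ₁ - w₀, q) ∈ (W.image fun w => κ₁ - w) ×ˢ X ×ˢ Y := fun hq =>
      mem_product.2 ⟨mem_image.2 ⟨w₀, hw₀, rfl⟩, hq⟩
    have := i₁ (mem_coe.2 (hm (mem_coe.1 hq))) (mem_coe.2 (hm (mem_coe.1 hq')))
      (by show κ₁ - w₀ + q.1 + q.2 = κ₁ - w₀ + q'.1 + q'.2
          simp only at e
          rw [show κ₁ - w₀ + q.1 + q.2 = (κ₁ + q.1 + q.2) - w₀ by abel, e]; abel)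
    exact (Prod.mk.inj this).2
  have j₂ : Set.InjOn (fun q : A × A => κ₂ - q.1 + q.2) ↑(X ×ˢ Y) := by
    intro q hq q' hq' e
    have hm : ∀ {q : A × A}, q ∈ (X ×ˢ Y : Finset (A × A)) →
        (w₀, κ₂ - q.1, q.2) ∈ W ×ˢ (X.image fun x => κ₂ - x) ×ˢ Y := fun hq =>
      mem_product.2 ⟨hw₀, mem_product.2 ⟨mem_image.2 ⟨_, (mem_product.1 hq).1, rfl⟩, (mem_product.1 hq).2⟩⟩
    have := i₂ (mem_coe.2 (hm (mem_coe.1 hq))) (mem_coe.2 (hm (mem_coe.1 hq')))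
      (by show w₀ + (κ₂ - q.1) + q.2 = w₀ + (κ₂ - q'.1) + q'.2
          simp only at e; rw [add_assoc, e, ← add_assoc])
    have h1 := (Prod.mk.inj (Prod.mk.inj this).2).1
    have h2 := (Prod.mk.inj (Prod.mk.inj this).2).2
    exact Prod.ext (sub_right_injective h1) h2
  have j₃ : Set.InjOn (fun q : A × A => κ₃ + q.1 - q.2) ↑(X ×ˢ Y) := by
    intro q hq q' hq' e
    have hm : ∀ {q : A × A}, q ∈ (X ×ˢ Y : Finset (A × A)) →
        (w₀, q.1, κ₃ - q.2) ∈ W ×ˢ X ×ˢ (Y.image fun y => κ₃ - y) := fun hq =>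
      mem_product.2 ⟨hw₀, mem_product.2 ⟨(mem_product.1 hq).1, mem_image.2 ⟨_, (mem_product.1 hq).2, rfl⟩⟩⟩
    have := i₃ (mem_coe.2 (hm (mem_coe.1 hq))) (mem_coe.2 (hm (mem_coe.1 hq')))
      (by show w₀ + q.1 + (κ₃ - q.2) = w₀ + q'.1 + (κ₃ - q'.2)
          simp only at e
          rw [show w₀ + q.1 + (κ₃ - q.2) = w₀ + (κ₃ + q.1 - q.2) by abel, e]; abel)
    have h1 := (Prod.mk.inj (Prod.mk.inj this).2).1
    have h2 := (Prod.mk.inj (Prod.mk.inj this).2).2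
    exact Prod.ext h1 (sub_right_injective h2)
  -- the two up-families are disjoint
  have dT : Disjoint ((X ×ˢ Y).image fun q : A × A => κ₂ - q.1 + q.2)
      ((X ×ˢ Y).image fun q : A × A => κ₃ + q.1 - q.2) := by
    refine disjoint_left.2 fun t ht ht' => ?_
    obtain ⟨⟨x, y⟩, hq, rfl⟩ := mem_image.1 ht
    obtain ⟨⟨x', y'⟩, hq', he⟩ := mem_image.1 ht'
    refine disjoint_left.1 d₂₃ (mem_image.2 ⟨(w₀, κ₂ - x, y), ?_, rfl⟩) (mem_image.2 ⟨(w₀, x', κ₃ - y'), ?_, ?_⟩)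
    · exact mem_product.2 ⟨hw₀, mem_product.2 ⟨mem_image.2 ⟨x, (mem_product.1 hq).1, rfl⟩, (mem_product.1 hq).2⟩⟩
    · exact mem_product.2 ⟨hw₀, mem_product.2 ⟨(mem_product.1 hq').1, mem_image.2 ⟨y', (mem_product.1 hq').2, rfl⟩⟩⟩
    · show w₀ + x' + (κ₃ - y') = w₀ + (κ₂ - x) + y
      simp only at he
      rw [show w₀ + x' + (κ₃ - y') = w₀ + (κ₃ + x' - y') by abel, he]; abel
  refine ⟨fun a => ?_, by rw [card_image_of_injOn j₁, card_product], ?_⟩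
  · rw [← card_filter_shifted₁ W X Y κ₁ a i₁, card_filter_eq_ite_of_injOn i₁]
    have eT : (T.filter fun t => a - t ∈ W).card =
        (((X ×ˢ Y).image fun q : A × A => κ₂ - q.1 + q.2).filter fun t => a - t ∈ W).card +
        (((X ×ˢ Y).image fun q : A × A => κ₃ + q.1 - q.2).filter fun t => a - t ∈ W).card := by
      show ((((X ×ˢ Y).image fun q : A × A => κ₂ - q.1 + q.2) ∪
        ((X ×ˢ Y).image fun q : A × A => κ₃ + q.1 - q.2)).filter fun t => a - t ∈ W).card = _
      rw [filter_union, card_union_of_disjoint (disjoint_filter_filter dT)]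
    rw [eT, ← card_filter_shifted₂ W X Y κ₂ a i₂, ← card_filter_shifted₃ W X Y κ₃ a i₃,
      card_filter_eq_ite_of_injOn i₂, card_filter_eq_ite_of_injOn i₃, ← add_assoc, ite_mem_add_three d₁₂ d₁₃ d₂₃, hcover]
    by_cases ha : a = x₀ <;> simp [ha]
  · show (((X ×ˢ Y).image fun q : A × A => κ₂ - q.1 + q.2) ∪ ((X ×ˢ Y).image fun q : A × A => κ₃ + q.1 - q.2)).card = _
    rw [card_union_of_disjoint dT, card_image_of_injOn j₂, card_image_of_injOn j₃, card_product, two_mul]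

/-- **A part of size three in a three-set SHIFTED form forces `|A| ≤ 12·ord(w' − w) + 7`** (any parity). [folklore] -/
theorem card_le_of_shifted_form_part_three {W X Y : Finset A} {κ₁ κ₂ κ₃ x₀ : A}
    (i₁ : Set.InjOn (fun p : A × A × A => p.1 + p.2.1 + p.2.2) ↑((W.image fun w => κ₁ - w) ×ˢ X ×ˢ Y))
    (i₂ : Set.InjOn (fun p : A × A × A => p.1 + p.2.1 + p.2.2) ↑(W ×ˢ (X.image fun x => κ₂ - x) ×ˢ Y))
    (i₃ : Set.InjOn (fun p : A × A × A => p.1 + p.2.1 + p.2.2) ↑(W ×ˢ X ×ˢ (Y.image fun y => κ₃ - y)))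
    (d₁₂ : Disjoint (((W.image fun w => κ₁ - w) ×ˢ X ×ˢ Y).image fun p : A × A × A => p.1 + p.2.1 + p.2.2)
      ((W ×ˢ (X.image fun x => κ₂ - x) ×ˢ Y).image fun p : A × A × A => p.1 + p.2.1 + p.2.2))
    (d₁₃ : Disjoint (((W.image fun w => κ₁ - w) ×ˢ X ×ˢ Y).image fun p : A × A × A => p.1 + p.2.1 + p.2.2)
      ((W ×ˢ X ×ˢ (Y.image fun y => κ₃ - y)).image fun p : A × A × A => p.1 + p.2.1 + p.2.2))
    (d₂₃ : Disjoint ((W ×ˢ (X.image fun x => κ₂ - x) ×ˢ Y).image fun p : A × A × A => p.1 + p.2.1 + p.2.2)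
      ((W ×ˢ X ×ˢ (Y.image fun y => κ₃ - y)).image fun p : A × A × A => p.1 + p.2.1 + p.2.2))
    (hcover : (((W.image fun w => κ₁ - w) ×ˢ X ×ˢ Y).image fun p : A × A × A => p.1 + p.2.1 + p.2.2) ∪
      ((W ×ˢ (X.image fun x => κ₂ - x) ×ˢ Y).image fun p : A × A × A => p.1 + p.2.1 + p.2.2) ∪
      ((W ×ˢ X ×ˢ (Y.image fun y => κ₃ - y)).image fun p : A × A × A => p.1 + p.2.1 + p.2.2) = univ.erase x₀)
    (hW : W.card = 3) {w w' : A} (hw : w ∈ W) (hw' : w' ∈ W) (hne : w ≠ w') :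
    Fintype.card A ≤ 12 * addOrderOf (w' - w) + 7 := by
  obtain ⟨htile, hM, hT⟩ := shifted_form_tiling ⟨w, hw⟩ i₁ i₂ i₃ d₁₂ d₁₃ d₂₃ hcover
  exact card_le_of_tiling_part_three htile hW (by rw [hT, hM]) hw hw' hne

/-- Hence: all element orders `≤ e` and `12e + 7 < |A|` ⇒ `|W| ≠ 3` in a three-set shifted form. [folklore] -/
theorem shifted_form_card_ne_three {W X Y : Finset A} {κ₁ κ₂ κ₃ x₀ : A}
    (i₁ : Set.InjOn (fun p : A × A × A => p.1 + p.2.1 + p.2.2) ↑((W.image fun w => κ₁ - w) ×ˢ X ×ˢ Y))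
    (i₂ : Set.InjOn (fun p : A × A × A => p.1 + p.2.1 + p.2.2) ↑(W ×ˢ (X.image fun x => κ₂ - x) ×ˢ Y))
    (i₃ : Set.InjOn (fun p : A × A × A => p.1 + p.2.1 + p.2.2) ↑(W ×ˢ X ×ˢ (Y.image fun y => κ₃ - y)))
    (d₁₂ : Disjoint (((W.image fun w => κ₁ - w) ×ˢ X ×ˢ Y).image fun p : A × A × A => p.1 + p.2.1 + p.2.2)
      ((W ×ˢ (X.image fun x => κ₂ - x) ×ˢ Y).image fun p : A × A × A => p.1 + p.2.1 + p.2.2))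
    (d₁₃ : Disjoint (((W.image fun w => κ₁ - w) ×ˢ X ×ˢ Y).image fun p : A × A × A => p.1 + p.2.1 + p.2.2)
      ((W ×ˢ X ×ˢ (Y.image fun y => κ₃ - y)).image fun p : A × A × A => p.1 + p.2.1 + p.2.2))
    (d₂₃ : Disjoint ((W ×ˢ (X.image fun x => κ₂ - x) ×ˢ Y).image fun p : A × A × A => p.1 + p.2.1 + p.2.2)
      ((W ×ˢ X ×ˢ (Y.image fun y => κ₃ - y)).image fun p : A × A × A => p.1 + p.2.1 + p.2.2))
    (hcover : (((W.image fun w => κ₁ - w) ×ˢ X ×ˢ Y).image fun p : A × A × A => p.1 + p.2.1 + p.2.2) ∪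
      ((W ×ˢ (X.image fun x => κ₂ - x) ×ˢ Y).image fun p : A × A × A => p.1 + p.2.1 + p.2.2) ∪
      ((W ×ˢ X ×ˢ (Y.image fun y => κ₃ - y)).image fun p : A × A × A => p.1 + p.2.1 + p.2.2) = univ.erase x₀)
    (e : ℕ) (he : ∀ x : A, addOrderOf x ≤ e) (hA : 12 * e + 7 < Fintype.card A) : W.card ≠ 3 := by
  intro hW
  obtain ⟨w, w', w'', hww', -, -, hWeq⟩ := card_eq_three.1 hW
  have hw : w ∈ W := by rw [hWeq]; simp
  have hw' : w' ∈ W := by rw [hWeq]; simp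
  have h := card_le_of_shifted_form_part_three i₁ i₂ i₃ d₁₂ d₁₃ d₂₃ hcover hW hw hw' hww'
  have := he (w' - w)
  omega

end Tiling

section Law

open Literature.Combinatorics.Additive

variable {A : Type} [AddCommGroup A] [DecidableEq A] [Fintype A] {G : Type} [Group G] [DecidableEq G]
  {ρ τ : A → G} {c₀ : A} {S T U : Finset G}

/-- The `ρ`-part of the FIRST set of a cube law triple has size `≠ 3` when all element orders are `≤ e` with `12e + 7 < |A|`
(any parity, any `c₀`). [folklore] -/
theorem cube_law_first_coset_part_ne_three
    (hρρ : ∀ a b, ρ a * ρ b = ρ (a + b)) (hρτ : ∀ a b, ρ a * τ b = τ (b - a))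
    (hτρ : ∀ a b, τ a * ρ b = τ (a + b)) (hττ : ∀ a b, τ a * τ b = ρ (c₀ + b - a))
    (hρ : Function.Injective ρ) (hτ : Function.Injective τ) (hne : ∀ a b, ρ a ≠ τ b)
    (hsurj : ∀ g, (∃ a, ρ a = g) ∨ (∃ a, τ a = g))
    (h : TripleProductProperty S T U)
    (hS : (univ.filter fun a : A => ρ a ∈ S).card = (univ.filter fun a : A => τ a ∈ S).card)
    (hT : (univ.filter fun a : A => ρ a ∈ T).card = (univ.filter fun a : A => τ a ∈ T).card)
    (hU : (univ.filter fun a : A => ρ a ∈ U).card = (univ.filter fun a : A => τ a ∈ U).card)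
    (hV : 3 * (S.card * T.card * U.card) + 8 = 8 * Fintype.card A)
    (e : ℕ) (he : ∀ x : A, addOrderOf x ≤ e) (hA : 12 * e + 7 < Fintype.card A) :
    (univ.filter fun a : A => ρ a ∈ S).card ≠ 3 := by
  obtain ⟨W, X, Y, κ₁, κ₂, κ₃, x₀, cW, -, -, -, i₁, i₂, i₃, d₁₂, d₁₃, d₂₃, hcover⟩ :=
    cube_shifted_form_of_law hρρ hρτ hτρ hττ hρ hτ hne hsurj h hS hT hU hV
  rw [← cW]
  exact shifted_form_card_ne_three i₁ i₂ i₃ d₁₂ d₁₃ d₂₃ hcover e he hA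

/-- **No coset part of size three in a cube law triple, ANY finite abelian `A` with small element orders** (kernel).
Let `G` be dihedral-like over `A` (any presentation constant `c₀`, any parity of `|A|`).  If every element of `A` has order
`≤ e` and `12e + 7 < |A|`, then a TPP triple `(S, T, U)` with cube coset parts (`|S₀| = |S₁|`, `|T₀| = |T₁|`, `|U₀| = |U₁|`)
attaining `3|S||T||U| + 8 = 8|A|` has `|S₀|, |T₀|, |U₀| ≠ 3`. [folklore] -/
theorem cube_law_no_coset_part_three_general
    (hρρ : ∀ a b, ρ a * ρ b = ρ (a + b)) (hρτ : ∀ a b, ρ a * τ b = τ (b - a))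
    (hτρ : ∀ a b, τ a * ρ b = τ (a + b)) (hττ : ∀ a b, τ a * τ b = ρ (c₀ + b - a))
    (hρ : Function.Injective ρ) (hτ : Function.Injective τ) (hne : ∀ a b, ρ a ≠ τ b)
    (hsurj : ∀ g, (∃ a, ρ a = g) ∨ (∃ a, τ a = g))
    (h : TripleProductProperty S T U)
    (hS : (univ.filter fun a : A => ρ a ∈ S).card = (univ.filter fun a : A => τ a ∈ S).card)
    (hT : (univ.filter fun a : A => ρ a ∈ T).card = (univ.filter fun a : A => τ a ∈ T).card)
    (hU : (univ.filter fun a : A => ρ a ∈ U).card = (univ.filter fun a : A => τ a ∈ U).card)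
    (hV : 3 * (S.card * T.card * U.card) + 8 = 8 * Fintype.card A)
    (e : ℕ) (he : ∀ x : A, addOrderOf x ≤ e) (hA : 12 * e + 7 < Fintype.card A) :
    (univ.filter fun a : A => ρ a ∈ S).card ≠ 3 ∧ (univ.filter fun a : A => ρ a ∈ T).card ≠ 3 ∧
      (univ.filter fun a : A => ρ a ∈ U).card ≠ 3 := by
  have hV' : 3 * (T.card * U.card * S.card) + 8 = 8 * Fintype.card A := by rw [← hV]; ring
  have hV'' : 3 * (U.card * S.card * T.card) + 8 = 8 * Fintype.card A := by rw [← hV]; ring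
  exact ⟨cube_law_first_coset_part_ne_three hρρ hρτ hτρ hττ hρ hτ hne hsurj h hS hT hU hV e he hA,
    cube_law_first_coset_part_ne_three hρρ hρτ hτρ hττ hρ hτ hne hsurj h.rotate hT hU hS hV' e he hA,
    cube_law_first_coset_part_ne_three hρρ hρτ hτρ hττ hρ hτ hne hsurj h.rotate.rotate hU hS hT hV'' e he hA⟩

/-- **Exponent form**: `12·exp(A) + 7 < |A|` ⇒ no coset part of size `3` (any parity). [folklore] -/
theorem cube_law_no_coset_part_three_general_of_exponent_lt
    (hρρ : ∀ a b, ρ a * ρ b = ρ (a + b)) (hρτ : ∀ a b, ρ a * τ b = τ (b - a))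
    (hτρ : ∀ a b, τ a * ρ b = τ (a + b)) (hττ : ∀ a b, τ a * τ b = ρ (c₀ + b - a))
    (hρ : Function.Injective ρ) (hτ : Function.Injective τ) (hne : ∀ a b, ρ a ≠ τ b)
    (hsurj : ∀ g, (∃ a, ρ a = g) ∨ (∃ a, τ a = g))
    (h : TripleProductProperty S T U)
    (hS : (univ.filter fun a : A => ρ a ∈ S).card = (univ.filter fun a : A => τ a ∈ S).card)
    (hT : (univ.filter fun a : A => ρ a ∈ T).card = (univ.filter fun a : A => τ a ∈ T).card)
    (hU : (univ.filter fun a : A => ρ a ∈ U).card = (univ.filter fun a : A => τ a ∈ U).card)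
    (hV : 3 * (S.card * T.card * U.card) + 8 = 8 * Fintype.card A)
    (hA : 12 * AddMonoid.exponent A + 7 < Fintype.card A) :
    (univ.filter fun a : A => ρ a ∈ S).card ≠ 3 ∧ (univ.filter fun a : A => ρ a ∈ T).card ≠ 3 ∧
      (univ.filter fun a : A => ρ a ∈ U).card ≠ 3 :=
  cube_law_no_coset_part_three_general hρρ hρτ hτρ hττ hρ hτ hne hsurj h hS hT hU hV (AddMonoid.exponent A)
    (fun x => AddMonoid.addOrderOf_le_exponent AddMonoid.ExponentExists.of_finite x) hA

end Law

section Square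

open Literature.Combinatorics.Additive

variable {n : ℕ} [NeZero n] {G : Type} [Group G] [DecidableEq G] {ρ τ : ZMod n × ZMod n → G}
  {c₀ : ZMod n × ZMod n} {S T U : Finset G}

/-- The first coset part over `ℤ_n × ℤ_n`, every `n ∉ {8, 10}` (any parity). [folklore] -/
theorem cube_law_first_coset_part_ne_three_zmod_sq (hn8 : n ≠ 8) (hn10 : n ≠ 10)
    (hρρ : ∀ a b, ρ a * ρ b = ρ (a + b)) (hρτ : ∀ a b, ρ a * τ b = τ (b - a))
    (hτρ : ∀ a b, τ a * ρ b = τ (a + b)) (hττ : ∀ a b, τ a * τ b = ρ (c₀ + b - a))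
    (hρ : Function.Injective ρ) (hτ : Function.Injective τ) (hne : ∀ a b, ρ a ≠ τ b)
    (hsurj : ∀ g, (∃ a, ρ a = g) ∨ (∃ a, τ a = g))
    (h : TripleProductProperty S T U)
    (hS : (univ.filter fun a : ZMod n × ZMod n => ρ a ∈ S).card =
      (univ.filter fun a : ZMod n × ZMod n => τ a ∈ S).card)
    (hT : (univ.filter fun a : ZMod n × ZMod n => ρ a ∈ T).card =
      (univ.filter fun a : ZMod n × ZMod n => τ a ∈ T).card)
    (hU : (univ.filter fun a : ZMod n × ZMod n => ρ a ∈ U).card =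
      (univ.filter fun a : ZMod n × ZMod n => τ a ∈ U).card)
    (hV : 3 * (S.card * T.card * U.card) + 8 = 8 * Fintype.card (ZMod n × ZMod n)) :
    (univ.filter fun a : ZMod n × ZMod n => ρ a ∈ S).card ≠ 3 := by
  have hcard : Fintype.card (ZMod n × ZMod n) = n * n := by rw [Fintype.card_prod, ZMod.card]
  obtain ⟨W, X, Y, κ₁, κ₂, κ₃, x₀, cW, -, -, hcount, i₁, i₂, i₃, d₁₂, d₁₃, d₂₃, hcover⟩ :=
    cube_shifted_form_of_law hρρ hρτ hτρ hττ hρ hτ hne hsurj h hS hT hU hV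
  rw [← cW]
  by_cases h13 : 13 ≤ n
  · exact shifted_form_card_ne_three i₁ i₂ i₃ d₁₂ d₁₃ d₂₃ hcover n addOrderOf_le_of_zmod_sq (by rw [hcard]; nlinarith)
  · intro hW
    have hle : W.card ≤ n * n := hcard ▸ card_le_univ W
    rw [hW] at hcount hle
    rw [hcard] at hcount
    have hn12 : n ≤ 12 := by omega
    have hc2 : 9 * (X.card * Y.card) + 1 = n * n := by rw [← hcount]; ring
    generalize X.card * Y.card = m at hc2
    clear hcount
    interval_cases n <;> omega

/-- **No coset part of size three in a cube law triple over `Dih(ℤ_n²)`, every `n ∉ {8, 10}`** (kernel; any parity, any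
presentation constant `c₀`; g33 had `n` prime, `ThreeSetNoPartThreeCorollaries` `n` odd; `n = 8` is covered by
`no_law_cube_13e_of_onto_z4z4`, `n = 10` remains computational). [folklore] -/
theorem cube_law_no_coset_part_three_zmod_sq (hn8 : n ≠ 8) (hn10 : n ≠ 10)
    (hρρ : ∀ a b, ρ a * ρ b = ρ (a + b)) (hρτ : ∀ a b, ρ a * τ b = τ (b - a))
    (hτρ : ∀ a b, τ a * ρ b = τ (a + b)) (hττ : ∀ a b, τ a * τ b = ρ (c₀ + b - a))
    (hρ : Function.Injective ρ) (hτ : Function.Injective τ) (hne : ∀ a b, ρ a ≠ τ b)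
    (hsurj : ∀ g, (∃ a, ρ a = g) ∨ (∃ a, τ a = g))
    (h : TripleProductProperty S T U)
    (hS : (univ.filter fun a : ZMod n × ZMod n => ρ a ∈ S).card =
      (univ.filter fun a : ZMod n × ZMod n => τ a ∈ S).card)
    (hT : (univ.filter fun a : ZMod n × ZMod n => ρ a ∈ T).card =
      (univ.filter fun a : ZMod n × ZMod n => τ a ∈ T).card)
    (hU : (univ.filter fun a : ZMod n × ZMod n => ρ a ∈ U).card =
      (univ.filter fun a : ZMod n × ZMod n => τ a ∈ U).card)
    (hV : 3 * (S.card * T.card * U.card) + 8 = 8 * Fintype.card (ZMod n × ZMod n)) :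
    (univ.filter fun a : ZMod n × ZMod n => ρ a ∈ S).card ≠ 3 ∧
      (univ.filter fun a : ZMod n × ZMod n => ρ a ∈ T).card ≠ 3 ∧
      (univ.filter fun a : ZMod n × ZMod n => ρ a ∈ U).card ≠ 3 := by
  have hV' : 3 * (T.card * U.card * S.card) + 8 = 8 * Fintype.card (ZMod n × ZMod n) := by rw [← hV]; ring
  have hV'' : 3 * (U.card * S.card * T.card) + 8 = 8 * Fintype.card (ZMod n × ZMod n) := by rw [← hV]; ring
  exact ⟨cube_law_first_coset_part_ne_three_zmod_sq hn8 hn10 hρρ hρτ hτρ hττ hρ hτ hne hsurj h hS hT hU hV,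
    cube_law_first_coset_part_ne_three_zmod_sq hn8 hn10 hρρ hρτ hτρ hττ hρ hτ hne hsurj h.rotate hT hU hS hV',
    cube_law_first_coset_part_ne_three_zmod_sq hn8 hn10 hρρ hρτ hτρ hττ hρ hτ hne hsurj h.rotate.rotate hU hS hT hV''⟩

end Square

end Summit.MatrixMultiplication.OmegaCensus
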